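import Summits.Ventures.AbcSig.Rows.XTemplateC2c
import Summits.Ventures.AbcSig.Levels.N2816

/-!
# Venture AbcSig — C2c ROW `C2cL11`: `A xⁿ + B yⁿ = 2 z²`, `A·B = 11^m` over the NORM-FORM level 2816 = 2⁸·11 (GENERATED by p-lean g4 `gen4/c2crow.py`)

HONEST FRAMING. A row of a COMPUTATION cell (`pub-abcsig`); a CONDITIONAL theorem, no claim on ABC or any summit.
Hypotheses: `BS04Package` (CITED); `DataComplete 2816` + `RefinesCPSymAll 2816` (COMPUTED: certified engine-1 level file, norm-form
certificates `Sieve/CharpolyCert.lean`); the listed per-orbit exclusions `hX_…` (CITED: the row of record's module closures, nothing of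
them checked here). Template `Rows/XTemplateC2c.lean` (case (ii)_C, level 2⁸·ℓ). Exponent range: prime `n ≥ 11`, `n ≠ 11`;
`1 ≤ m < n` — the REDUCED exponent range (RULING H1); p1's census predicate `Rows.C2cCell` is stated for `n ∤ m` (unreduced), so no
cell bridge is given here (the reduction m ↦ m mod n, y ↦ ℓ^q·y is routine but not formalised in this file).
Residual of record: none. No cited exclusion: every (orbit, exponent ≥ 11) pair is killed in the kernel.
Row of record: `census/rows/C2a/C2c-l11.md` (sha16 `c41a5a910c52fdf7`; SIGNED 2026-08-22T16:54:07Z by referee (ref-g12)).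
-/

namespace Summit.Ventures.AbcSig

/-- C2c row `C2cL11`, first distribution `xⁿ + 11^m·yⁿ = 2z²` (`B` written `2⁰·11^m`); prime `n ≥ 11`, `n ≠ 11`. -/
theorem xrow_C2cL11 (M : NewformModel) (hP : M.BS04Package)
    (hD2816 : M.DataComplete 2816 level2816Orbits) (hCP2816 : M.RefinesCPSymAll 2816 level2816CP)
    (n : ℕ) (hn : n.Prime) (hmin : 11 ≤ n) (hnℓ : n ≠ 11) (m : ℕ) (hm : 1 ≤ m) (hmn : m < n)
    (x y z : ℤ) (hxy1 : x * y ≠ 1) (hxy2 : x * y ≠ -1) : ¬ IsPrimitiveSolution 1 (2 ^ 0 * 11 ^ m) 2 n x y z := by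
  have hℓ : Nat.Prime 11 := by norm_num
  have h7 : 7 ≤ n := by omega
  exact xrow_template_C2c 11 hℓ (by norm_num) M hP hD2816 n hn h7 hnℓ m hm hmn
    (level2816_sieve M hP hCP2816 n hn h7 (fun o => M.Excludes 2816 o (famC2c 11 m n) ∨ M.ExcludesStd 2816 o n) (fun _ h => Or.inr h) (fun hmem => by
      obtain rfl : n = 7 := by simpa using hmem
      omega) (fun hmem => by
      obtain rfl : n = 7 := by simpa using hmem
      omega) (fun hmem => by
      obtain rfl : n = 7 := by simpa using hmem
      omega) (fun hmem => by
      obtain rfl : n = 7 := by simpa using hmem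
      omega) (fun hmem => by
      obtain rfl : n = 7 := by simpa using hmem
      omega) (fun hmem => by
      obtain rfl : n = 7 := by simpa using hmem
      omega))
    x y z hxy1 hxy2

/-- C2c row `C2cL11`, second distribution `11^m·xⁿ + yⁿ = 2z²` (by `IsPrimitiveSolution.swap`). -/
theorem xrow_C2cL11_swap (M : NewformModel) (hP : M.BS04Package)
    (hD2816 : M.DataComplete 2816 level2816Orbits) (hCP2816 : M.RefinesCPSymAll 2816 level2816CP)
    (n : ℕ) (hn : n.Prime) (hmin : 11 ≤ n) (hnℓ : n ≠ 11) (m : ℕ) (hm : 1 ≤ m) (hmn : m < n)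
    (x y z : ℤ) (hxy1 : x * y ≠ 1) (hxy2 : x * y ≠ -1) : ¬ IsPrimitiveSolution (2 ^ 0 * 11 ^ m) 1 2 n x y z := by
  intro h
  exact xrow_C2cL11 M hP hD2816 hCP2816 n hn hmin hnℓ m hm hmn  y x z (by rwa [mul_comm]) (by rwa [mul_comm]) h.swap

end Summit.Ventures.AbcSig
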